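import Summits.NavierStokesRegularity.FluidComputer.ClayBlowupZoomHalfPlane
import Summits.NavierStokesRegularity.FluidComputer.ClayBlowupZoomTypeI
import Summits.NavierStokesRegularity.NavierStokesRegularity.Theorems.AxisymmetricLiouvilleBoundedSwirl
import Literature.Analysis.FluidPDE.KNSSTypeIRateLimit
import Literature.Analysis.FluidPDE.KNSSLineInvariantLiouville
import Literature.Analysis.FluidPDE.KNSSThm53OfWindow
import HarnessLib

/-!
# AXISYMMETRIC TYPE I WITH THE CLAY FORCE REDUCES TO KNSS's OPEN LIOUVILLE PROBLEM: an axisymmetric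
# Clay blow-up — WITH its Clay force — is Type II, conditionally on (AX-L)

Cell `ns-blowup`, seat `ns-blowup-ecbridge-2` (g10; the E–C endpoint theory seat). LABEL: E–C typing
(KERNEL — conditional on the tree's `@[conjecture]` `AxisymmetricLiouvilleBoundedSwirl`, taken as an
explicit hypothesis; no named fact). WHAT THIS IS NOT: not Navier–Stokes evidence — a necessary
condition on the TYPE `ClayBlowup ν` (no inhabitant is claimed anywhere); (AX-L) is NOT asserted.
Companion memo: `run/shared/lean/pub/ns-blowup/ecbridge2/ECBRIDGE-2-MEMO-9.md`.

## Content

g7 typed the Seregin–Šverák half of K8 («an axisymmetric blow-up is not Type I in time») only for the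
UNFORCED type, through Seregin–Šverák 2009's LOCAL theory, which has no forced version in the tree. The
zoom with force gives a GLOBAL route (KNSS 2009 §6): with the centres on the meridian half-plane
(`exists_zoom_limit_halfPlane`) the zoom slices are axisymmetric about the vertical axes through
`−m_k e₀`, `m_k = M_k r(x_k)` (`zoom_halfPlane_rot_about`). DICHOTOMY along the extracted subsequence:

* RECEDING AXES (`m_k → ∞`): the limit is invariant along `e₁` (the tree's sliding lemma
  `eq_of_tendstoLocallyUniformly_of_rot_about`, KNSS p. 13) hence constant in space on every slice
  (the tree's 2½-D Liouville theorem `apply_eq_apply_zero_of_lineInvariant`) — impossible under Type I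
  (`false_of_sliceConst_of_typeI_decay`), UNCONDITIONALLY;
* BOUNDED OFFSETS (`m_k ↛ ∞`): after a convergent shift the limit `V = W(·, · + a₀)` is an
  AXISYMMETRIC bounded ancient mild solution with BOUNDED SWIRL (`|r V_θ| ≤ sup|r u_θ|`, g8's forced
  swirl maximum principle `swirl_bounded`, scale invariance of `Γ`) and Type-I decay — exactly an
  instance of KNSS's OPEN axisymmetric-with-swirl Liouville problem (AX-L, tree
  `AxisymmetricLiouvilleBoundedSwirl`); IF (AX-L) holds, `V` is slice-constant, impossible again.

* **`ClayBlowup.not_typeI_of_isAxisymmetric_forced_of_liouville`** (`ν > 0`, axisymmetric datum and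
  force): `AxisymmetricLiouvilleBoundedSwirl → ¬ IsTypeIBlowup X.u X.T`. The K8 row WITH force thus
  stands: KNSS half KERNEL (`ClayBlowupForcedAxisDecay`), Seregin–Šverák half KERNEL MODULO (AX-L).

References: Koch–Nadirashvili–Seregin–Šverák, Acta Math. 203 (2009), §5 (after Thm 5.2: the open
problem), §6 Thms 6.1–6.2 [cite: KochNadirashviliSereginSverak2009, Thm 6.2 and §5]; Seregin–Šverák,
Comm. PDE 34 (2009), Thm 1.1 [cite: SereginSverak2009, Thm 1.1]; C. L. Fefferman, (C)
[cite: FeffermanClay2006, (C)].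
-/

noncomputable section

namespace Summit.NavierStokesRegularity.FluidComputer

open Set MeasureTheory Filter Topology Function Metric
open scoped ENNReal NNReal
open Literature.Analysis Literature.Analysis.FluidPDE
open Summit.NavierStokesRegularity.NavierStokesRegularity

/-! ## §1 Small tools -/

/-- `a • e₀ = single 0 a`. [folklore] -/
theorem smul_single_zero_one (a : ℝ) :
    a • (EuclideanSpace.single (0 : Fin 3) (1 : ℝ) : EuclideanSpace ℝ (Fin 3)) =
      EuclideanSpace.single 0 a := by
  ext i
  by_cases h : i = 0
  · subst h; simp
  · simp [h]

/-- A locally uniformly convergent sequence stays so after an eventual modification. [folklore] -/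
theorem tendstoLocallyUniformly_congr_eventually {α β : Type*} [TopologicalSpace α]
    [UniformSpace β] {F G : ℕ → α → β} {f : α → β} (h : TendstoLocallyUniformly F f atTop)
    (heq : ∀ᶠ n in atTop, G n = F n) : TendstoLocallyUniformly G f atTop := by
  intro u hu y
  obtain ⟨s, hs, hev⟩ := h u hu y
  exact ⟨s, hs, (hev.and heq).mono fun n hn z hz => by rw [hn.2]; exact hn.1 z hz⟩

namespace ClayBlowup

/-- The force of the viscosity-normalised blow-up is `(ν/μ)² • f((ν/μ) t, x)`. [folklore] -/
theorem rescale_f_apply {μ ν : ℝ} (Y : ClayBlowup μ) (hμ : 0 < μ) (hν : 0 < ν) (s : ℝ)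
    (y : EuclideanSpace ℝ (Fin 3)) :
    (Y.rescale hμ hν).f s y = (ν / μ) ^ 2 • Y.f (ν / μ * s) y := rfl

/-! ## §2 The axisymmetric Type-I row with force, modulo (AX-L), viscosity `1` -/

/-- **AN AXISYMMETRIC CLAY BLOW-UP WITH ITS CLAY FORCE IS TYPE II — CONDITIONALLY ON (AX-L)**
(`ν = 1` core; no named fact; the conjecture is a hypothesis). See the module docstring for the
dichotomy: receding axes are excluded unconditionally (sliding lemma + 2½-D Liouville + Type-I decay);
bounded offsets produce an axisymmetric bounded ancient mild solution with bounded swirl and Type-I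
decay, which (AX-L) makes slice-constant — impossible.
[cite: KochNadirashviliSereginSverak2009, Thm 6.2 and §5] -/
theorem not_typeI_of_isAxisymmetric_forced_one_of_liouville (Y : ClayBlowup 1)
    (h0A : IsAxisymmetric (Y.u 0)) (hfA : ∀ t ∈ Ico 0 Y.T, IsAxisymmetric (Y.f t))
    (hL : Summit.NavierStokesRegularity.NavierStokesRegularity.AxisymmetricLiouvilleBoundedSwirl) : ¬ IsTypeIBlowup Y.u Y.T := by
  rintro ⟨C, hC⟩
  have hT := Y.T_pos
  have hax : ∀ t ∈ Ico 0 Y.T, IsAxisymmetric (Y.u t) := Y.isAxisymmetric one_pos h0A hfA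
  obtain ⟨CΓ, -, hΓ⟩ := Y.swirl_bounded one_pos h0A hfA
  obtain ⟨t, x, c, φ, W, δ, hφ, hδ, ht, hhalf, hc, hc01, hk1, hnear, -, hWc, hWdiv, hWmild, -, hW1,
    -, hknss, -, hconv⟩ := Y.exists_zoom_limit_halfPlane h0A hfA
  have hc0 : ∀ k, 0 < c k := fun k => (hc01 k).1
  have hM0 : ∀ k, 0 < ‖Y.u (t k) (x k)‖ := fun k => lt_of_lt_of_le (by positivity) (hk1 k)
  have hcM : ∀ k, c k * ‖Y.u (t k) (x k)‖ = 1 := fun k => by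
    rw [hc k]; exact inv_mul_cancel₀ (hM0 k).ne'
  -- ### the limit on `(−∞, 0)`
  have hpt : ∀ s < 0, ∀ y, Tendsto
      (fun j => (c (φ j) • stPull (c (φ j) ^ 2) (c (φ j)) (t (φ j)) (x (φ j)) Y.u) s y) atTop
      (𝓝 (W s y)) := fun s hs y =>
    ((hconv s (hs.trans hδ)).tendstoLocallyUniformlyOn (s := univ)).tendsto_at (mem_univ y)
  have hWc0 : ContinuousOn (uncurry W) (Iio 0 ×ˢ univ) :=
    hWc.mono (prod_mono (fun s hs => lt_trans hs hδ) subset_rfl)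
  have hWdiv0 : ∀ s < 0, IsWeaklyDivFree (W s) := fun s hs => hWdiv s (hs.trans hδ)
  have hWmild0 : ∀ s τ : ℝ, s < τ → τ < 0 → ∀ y,
      W τ y = UnboundedOperators.heatExtension (W s) (τ - s) y - oseenDuhamel 1 s W W τ y :=
    fun s τ hsτ hτ y => hWmild s τ hsτ (hτ.trans hδ) y
  have hWbd0 : ∀ s < 0, ∀ y, ‖W s y‖ ≤ 1 := fun s hs y => hW1 s hs.le y
  obtain ⟨hsm, -⟩ := smooth_and_bounds_of_bounded_ancient_oseenMild hWc0 hWdiv0 hWmild0 hWbd0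
  have hslice : ∀ s < 0, ContDiff ℝ (⊤ : ℕ∞) (W s) := fun s hs =>
    hsm.comp_contDiff (contDiff_prodMk_right s) fun y => mk_mem_prod (mem_Iio.2 hs) (mem_univ y)
  have hWsc : ∀ s < δ, Continuous (W s) := fun s hs =>
    hWc.comp_continuous (Continuous.prodMk_right s) fun y => ⟨hs, mem_univ y⟩
  have hIW : ∀ s < 0, ∀ y, Real.sqrt (-s) * ‖W s y‖ ≤ C := Y.typeI_decay_of_zoom hC ht hc hk1 hφ hpt
  have hnt : ∃ s < 0, ∃ y, W s y ≠ 0 := by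
    obtain ⟨s, hs, y, hy⟩ := hknss.exists_lt_norm (1 / 2) (by norm_num)
    exact ⟨s, hs, y, fun h => by rw [h, norm_zero] at hy; linarith⟩
  have hmem : ∀ s ≤ 0, ∀ᶠ j in atTop, t (φ j) + c (φ j) ^ 2 * s ∈ Ioc 0 (t (φ j)) :=
    fun s hs => Y.zoom_time_mem_eventually ht hc hk1 hφ hs
  -- ### the rescaled axial offsets `m_k = c_k⁻¹ (x_k)₀ ≥ 0` and the symmetry of the zoom slices
  set m : ℕ → ℝ := fun k => (c k)⁻¹ * x k 0 with hm
  have hm0 : ∀ k, 0 ≤ m k := fun k => mul_nonneg (inv_nonneg.2 (hc0 k).le) (hhalf k).2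
  have hsym : ∀ k s, t k + c k ^ 2 * s ∈ Ico 0 Y.T → ∀ (θ : ℝ) (y : EuclideanSpace ℝ (Fin 3)),
      (c k • stPull (c k ^ 2) (c k) (t k) (x k) Y.u) s
          (EuclideanSpace.single 0 (-m k) + rotZ θ (y - EuclideanSpace.single 0 (-m k))) =
        rotZ θ ((c k • stPull (c k ^ 2) (c k) (t k) (x k) Y.u) s y) := by
    intro k s hs θ y
    have h := Y.zoom_halfPlane_rot_about hax (hc0 k) (hhalf k).1 hs θ y
    rwa [smul_single_zero_one] at h
  -- ### DICHOTOMY on the offsets along `φ`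
  by_cases hB : ∃ B : ℝ, ∃ᶠ j in atTop, m (φ j) ≤ B
  · -- #### bounded offsets: a convergent shift, an axisymmetric limit with bounded swirl
    obtain ⟨B, hfreq⟩ := hB
    obtain ⟨m₀, -, ψ, hψ, hmlim⟩ := tendsto_subseq_of_frequently_bounded (Metric.isBounded_Icc (0 : ℝ) B)
      (x := fun j => m (φ j)) (hfreq.mono fun j hj => ⟨hm0 _, hj⟩)
    set a₀ : EuclideanSpace ℝ (Fin 3) := EuclideanSpace.single 0 (-m₀) with ha₀
    have haconv : Tendsto (fun j => (EuclideanSpace.single 0 (-m (φ (ψ j))) : EuclideanSpace ℝ (Fin 3)))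
        atTop (𝓝 a₀) := by
      have h1 : Tendsto (fun j => -m (φ (ψ j))) atTop (𝓝 (-m₀)) := hmlim.neg
      have h2 := h1.smul_const (EuclideanSpace.single (0 : Fin 3) (1 : ℝ) : EuclideanSpace ℝ (Fin 3))
      simp only [smul_single_zero_one] at h2
      exact h2
    -- convergence along the sub-subsequence, at moving points
    have hconvψ : ∀ s < δ, TendstoLocallyUniformly
        (fun j => (c (φ (ψ j)) • stPull (c (φ (ψ j)) ^ 2) (c (φ (ψ j))) (t (φ (ψ j))) (x (φ (ψ j)))
          Y.u) s) (W s) atTop := fun s hs =>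
      tendstoLocallyUniformly_comp_of_tendsto (hconv s hs) hψ.tendsto_atTop
    have hlim : ∀ s < δ, ∀ z : EuclideanSpace ℝ (Fin 3), Tendsto
        (fun j => (c (φ (ψ j)) • stPull (c (φ (ψ j)) ^ 2) (c (φ (ψ j))) (t (φ (ψ j))) (x (φ (ψ j)))
          Y.u) s (EuclideanSpace.single 0 (-m (φ (ψ j))) + z)) atTop (𝓝 (W s (a₀ + z))) :=
      fun s hs z => (hconvψ s hs).tendsto_comp (hWsc s hs).continuousAt (haconv.add tendsto_const_nhds)
    have hmemψ : ∀ s ≤ 0, ∀ᶠ j in atTop,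
        t (φ (ψ j)) + c (φ (ψ j)) ^ 2 * s ∈ Ico 0 Y.T := by
      intro s hs
      filter_upwards [hψ.tendsto_atTop.eventually (hmem s hs)] with j hj
      exact ⟨hj.1.le, hj.2.trans_lt (ht _).2⟩
    -- the shifted limit `V(s, y) = W(s, y + a₀)`
    -- (i) axisymmetric slices
    have hVax : ∀ s < 0, IsAxisymmetric (fun y => W s (y + a₀)) := by
      intro s hs θ y
      simp only
      rw [add_comm (rotZ θ y) a₀, add_comm y a₀]
      have h1 := hlim s (hs.trans hδ) (rotZ θ y)
      have h2 := (continuous_rotZ θ).continuousAt.tendsto.comp (hlim s (hs.trans hδ) y)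
      have hev : ∀ᶠ j in atTop,
          (c (φ (ψ j)) • stPull (c (φ (ψ j)) ^ 2) (c (φ (ψ j))) (t (φ (ψ j))) (x (φ (ψ j))) Y.u) s
              (EuclideanSpace.single 0 (-m (φ (ψ j))) + rotZ θ y) =
            rotZ θ ((c (φ (ψ j)) • stPull (c (φ (ψ j)) ^ 2) (c (φ (ψ j))) (t (φ (ψ j)))
              (x (φ (ψ j))) Y.u) s (EuclideanSpace.single 0 (-m (φ (ψ j))) + y)) := by
        filter_upwards [hmemψ s hs.le] with j hj
        have h := hsym (φ (ψ j)) s hj θ (EuclideanSpace.single 0 (-m (φ (ψ j))) + y)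
        rwa [add_sub_cancel_left] at h
      exact tendsto_nhds_unique (h1.congr' hev) h2
    -- (ii) bounded swirl
    have hVswirl : ∀ s < 0, ∀ y : EuclideanSpace ℝ (Fin 3), |swirl (fun y => W s (y + a₀)) y| ≤ CΓ := by
      intro s hs y
      have hcomp : ∀ i : Fin 3, Continuous fun v : EuclideanSpace ℝ (Fin 3) => v i := fun i =>
        (EuclideanSpace.proj i).continuous
      have h1 : Tendsto (fun j => |y 0 * ((c (φ (ψ j)) • stPull (c (φ (ψ j)) ^ 2) (c (φ (ψ j)))
          (t (φ (ψ j))) (x (φ (ψ j))) Y.u) s (EuclideanSpace.single 0 (-m (φ (ψ j))) + y)) 1 -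
          y 1 * ((c (φ (ψ j)) • stPull (c (φ (ψ j)) ^ 2) (c (φ (ψ j))) (t (φ (ψ j))) (x (φ (ψ j)))
          Y.u) s (EuclideanSpace.single 0 (-m (φ (ψ j))) + y)) 0|) atTop
          (𝓝 |y 0 * W s (a₀ + y) 1 - y 1 * W s (a₀ + y) 0|) :=
        ((((hcomp 1).tendsto _).comp (hlim s (hs.trans hδ) y)).const_mul (y 0) |>.sub
          ((((hcomp 0).tendsto _).comp (hlim s (hs.trans hδ) y)).const_mul (y 1))).abs
      have hev : ∀ᶠ j in atTop, |y 0 * ((c (φ (ψ j)) • stPull (c (φ (ψ j)) ^ 2) (c (φ (ψ j)))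
          (t (φ (ψ j))) (x (φ (ψ j))) Y.u) s (EuclideanSpace.single 0 (-m (φ (ψ j))) + y)) 1 -
          y 1 * ((c (φ (ψ j)) • stPull (c (φ (ψ j)) ^ 2) (c (φ (ψ j))) (t (φ (ψ j))) (x (φ (ψ j)))
          Y.u) s (EuclideanSpace.single 0 (-m (φ (ψ j))) + y)) 0| ≤ CΓ := by
        filter_upwards [hmemψ s hs.le] with j hj
        set k := φ (ψ j) with hk
        -- the physical point `z = x_k + c_k (a_k + y)` has `z₀ = c_k y₀`, `z₁ = c_k y₁`
        set z : EuclideanSpace ℝ (Fin 3) := x k + c k • (EuclideanSpace.single 0 (-m k) + y) with hz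
        have hck : c k ≠ 0 := (hc0 k).ne'
        have hz0 : z 0 = c k * y 0 := by
          simp [hz, hm]
          field_simp
          ring
        have hz1 : z 1 = c k * y 1 := by
          simp [hz, hm, (hhalf k).1]
        have hΓz := hΓ _ hj z
        rw [swirl] at hΓz
        simp only [smul_stPull_apply, PiLp.smul_apply, smul_eq_mul]
        rw [← hz]
        have e : y 0 * (c k * Y.u (t k + c k ^ 2 * s) z 1) - y 1 * (c k * Y.u (t k + c k ^ 2 * s) z 0) =
            z 0 * Y.u (t k + c k ^ 2 * s) z 1 - z 1 * Y.u (t k + c k ^ 2 * s) z 0 := by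
          rw [hz0, hz1]; ring
        rw [e]
        exact hΓz
      have h := le_of_tendsto h1 hev
      rw [swirl]
      simpa [add_comm y a₀] using h
    -- (iii) the shifted limit is a bounded ancient mild solution, continuous, measurable slices
    have hVcont : ContinuousOn (uncurry fun s y => W s (y + a₀)) (Iio 0 ×ˢ univ) := by
      have hmap : Continuous fun z : ℝ × EuclideanSpace ℝ (Fin 3) => (z.1, z.2 + a₀) :=
        continuous_fst.prodMk (continuous_snd.add continuous_const)
      exact hWc.comp hmap.continuousOn fun z hz => ⟨lt_trans hz.1 hδ, mem_univ _⟩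
    have hVmild : ∀ s τ : ℝ, s < τ → τ < 0 → ∀ y,
        (fun s y => W s (y + a₀)) τ y =
          UnboundedOperators.heatExtension ((fun s y => W s (y + a₀)) s) (τ - s) y -
            oseenDuhamel 1 s (fun s y => W s (y + a₀)) (fun s y => W s (y + a₀)) τ y := by
      intro s τ hsτ hτ y
      show W τ (y + a₀) = UnboundedOperators.heatExtension (fun z => W s (z + a₀)) (τ - s) y -
        oseenDuhamel 1 s (fun σ z => W σ (z + a₀)) (fun σ z => W σ (z + a₀)) τ y
      rw [oseenDuhamel_comp_add_right 1 s W W a₀ τ y, heatExtension_comp_add_right'',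
        hWmild0 s τ hsτ hτ (y + a₀)]
    have hVdiv : ∀ s < 0, IsWeaklyDivFree ((fun s y => W s (y + a₀)) s) := fun s hs =>
      (hWdiv0 s hs).comp_add_right' a₀
    have hVbd : ∀ s < 0, ∀ y, ‖(fun s y => W s (y + a₀)) s y‖ ≤ 1 := fun s hs y => hWbd0 s hs _
    have hVanc : IsBoundedAncientMildSolution 1 (fun s y => W s (y + a₀)) :=
      isBoundedAncientMildSolution_of_oseen one_pos hVcont ⟨1, hVbd⟩ hVdiv
        (fun s τ hsτ hτ y => by rw [one_mul]; exact hVmild s τ hsτ hτ y)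
    have hVslc : ∀ s < 0, Continuous (fun y => W s (y + a₀)) := fun s hs =>
      (hWsc s (hs.trans hδ)).comp (continuous_id.add continuous_const)
    -- (AX-L) makes the shifted limit slice-constant
    have hconst : ∀ s < 0, ∀ y, (fun s y => W s (y + a₀)) s y = (fun s y => W s (y + a₀)) s 0 := by
      intro s hs y
      obtain ⟨b, hb⟩ := hL _ hVanc (fun s hs => (hVslc s hs).aestronglyMeasurable) hVax
        ⟨CΓ, hVswirl⟩ s hs
      have heq : (fun y => W s (y + a₀)) = fun _ => b :=
        ((hVslc s hs).ae_eq_iff_eq volume continuous_const).1 hb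
      have h1 := congrFun heq y
      have h2 := congrFun heq 0
      simp only at h1 h2 ⊢
      rw [h1, h2]
    -- contradiction
    refine false_of_sliceConst_of_typeI_decay (C := C) (V := fun s y => W s (y + a₀))
      (fun s hs => ((hslice s hs).of_le (by norm_cast)).comp (contDiff_id.add contDiff_const))
      ⟨1, hVbd⟩ hVdiv hVmild ?_ (fun s hs y => hIW s hs _) hconst
    obtain ⟨s₀, hs₀, y₀, hy₀⟩ := hnt
    exact ⟨s₀, hs₀, y₀ - a₀, by simpa using hy₀⟩
  · -- #### receding axes: the limit is invariant along `e₁`, hence slice-constant — impossible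
    have hMt : Tendsto (fun j => m (φ j)) atTop atTop := by
      refine tendsto_atTop.2 fun B => ?_
      have h : ¬ ∃ᶠ j in atTop, m (φ j) ≤ B := fun h => hB ⟨B, h⟩
      exact (Filter.not_frequently.1 h).mono fun j hj => (not_le.1 hj).le
    have hinv : ∀ s < 0, ∀ (y : EuclideanSpace ℝ (Fin 3)) (d : ℝ),
        W s (y + EuclideanSpace.single 1 d) = W s y := by
      intro s hs y d
      -- the zoom slices, set to `0` while the slice time is not yet in `[0, T)`
      let Z : ℕ → EuclideanSpace ℝ (Fin 3) → EuclideanSpace ℝ (Fin 3) := fun j =>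
        if t (φ j) + c (φ j) ^ 2 * s ∈ Ico 0 Y.T then
          (c (φ j) • stPull (c (φ j) ^ 2) (c (φ j)) (t (φ j)) (x (φ j)) Y.u) s else 0
      have hZsym : ∀ j (θ : ℝ) (z : EuclideanSpace ℝ (Fin 3)),
          Z j (EuclideanSpace.single 0 (-m (φ j)) + rotZ θ (z - EuclideanSpace.single 0 (-m (φ j)))) =
            rotZ θ (Z j z) := by
        intro j θ z
        by_cases hv : t (φ j) + c (φ j) ^ 2 * s ∈ Ico 0 Y.T
        · simp only [Z, if_pos hv]; exact hsym (φ j) s hv θ z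
        · simp only [Z, if_neg hv, Pi.zero_apply, rotZ_apply_zero_vec]
      have hZconv : TendstoLocallyUniformly Z (W s) atTop := by
        refine tendstoLocallyUniformly_congr_eventually (hconv s (hs.trans hδ)) ?_
        filter_upwards [hmem s hs.le] with j hj
        simp only [Z, if_pos (show t (φ j) + c (φ j) ^ 2 * s ∈ Ico 0 Y.T from
          ⟨hj.1.le, hj.2.trans_lt (ht _).2⟩)]
      exact eq_of_tendstoLocallyUniformly_of_rot_about hMt hZsym hZconv (hWsc s (hs.trans hδ)) y d
    have hconst := apply_eq_apply_zero_of_lineInvariant hknss.isBoundedAncientMildSolution hWc0 hinv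
    exact false_of_sliceConst_of_typeI_decay (C := C) (fun s hs => (hslice s hs).of_le (by norm_cast))
      ⟨1, hWbd0⟩ hWdiv0 hWmild0 hnt hIW hconst

/-! ## §3 Every viscosity; the K8 row with force -/

/-- **AN AXISYMMETRIC CLAY BLOW-UP — WITH ITS CLAY FORCE — IS TYPE II, CONDITIONALLY ON KNSS's
AXISYMMETRIC LIOUVILLE PROBLEM (AX-L)** (`ν > 0`; axisymmetric datum and Clay force; no named fact;
the conjecture `AxisymmetricLiouvilleBoundedSwirl` is a HYPOTHESIS). Supersedes, modulo (AX-L), the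
first clause of g7's `not_typeI_of_isAxisymmetric` (which needs `X.f = 0`); the second clause holds
with force unconditionally (`not_cylRadius_mul_norm_le_of_isAxisymmetric`).
[cite: KochNadirashviliSereginSverak2009, Thm 6.2 and §5] [cite: SereginSverak2009, Thm 1.1] -/
theorem not_typeI_of_isAxisymmetric_forced_of_liouville {ν : ℝ} (X : ClayBlowup ν) (hν : 0 < ν)
    (h0A : IsAxisymmetric (X.u 0)) (hfA : ∀ t ∈ Ico 0 X.T, IsAxisymmetric (X.f t))
    (hL : Summit.NavierStokesRegularity.NavierStokesRegularity.AxisymmetricLiouvilleBoundedSwirl) : ¬ IsTypeIBlowup X.u X.T := by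
  intro hI
  set a : ℝ := 1 / ν with ha
  have ha0 : 0 < a := by positivity
  have hmaps : ∀ s ∈ Ico 0 (X.rescale hν one_pos).T, a * s ∈ Ico 0 X.T := by
    intro s hs
    rw [X.rescale_T hν one_pos] at hs
    refine ⟨mul_nonneg ha0.le hs.1, ?_⟩
    have := mul_lt_mul_of_pos_left hs.2 ha0
    rwa [mul_div_cancel₀ _ ha0.ne'] at this
  have h0A' : IsAxisymmetric ((X.rescale hν one_pos).u 0) := by
    have e : (X.rescale hν one_pos).u 0 = fun y => a • X.u 0 y := by
      funext y; rw [X.rescale_u_apply hν one_pos, mul_zero]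
    rw [e]; exact h0A.const_smul a
  have hfA' : ∀ s ∈ Ico 0 (X.rescale hν one_pos).T, IsAxisymmetric ((X.rescale hν one_pos).f s) := by
    intro s hs
    have e : (X.rescale hν one_pos).f s = fun y => a ^ 2 • X.f (a * s) y := by
      funext y; rw [X.rescale_f_apply hν one_pos]
    rw [e]; exact (hfA (a * s) (hmaps s hs)).const_smul _
  exact (X.rescale hν one_pos).not_typeI_of_isAxisymmetric_forced_one_of_liouville h0A' hfA' hL
    (X.isTypeIBlowup_rescale hν one_pos hI)

/-- **THE K8 ROW WITH THE CLAY FORCE, MODULO (AX-L)** (`ν > 0`, axisymmetric datum and force): IF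
`AxisymmetricLiouvilleBoundedSwirl` holds then NEITHER the Type I bound `‖u(t,x)‖ ≤ C/√(T − t)` near
`T` NOR the bound `r‖u(t,x)‖ ≤ C` on `[0, T) × ℝ³` holds — the second clause unconditionally
(`not_cylRadius_mul_norm_le_of_isAxisymmetric`). [cite: KochNadirashviliSereginSverak2009, Thms 6.1–6.2] -/
theorem not_typeI_of_isAxisymmetric_forced {ν : ℝ} (X : ClayBlowup ν) (hν : 0 < ν)
    (h0A : IsAxisymmetric (X.u 0)) (hfA : ∀ t ∈ Ico 0 X.T, IsAxisymmetric (X.f t))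
    (hL : Summit.NavierStokesRegularity.NavierStokesRegularity.AxisymmetricLiouvilleBoundedSwirl) :
    ¬ IsTypeIBlowup X.u X.T ∧
      ¬ ∃ C : ℝ, ∀ t ∈ Ico 0 X.T, ∀ x : EuclideanSpace ℝ (Fin 3), cylRadius x * ‖X.u t x‖ ≤ C :=
  ⟨X.not_typeI_of_isAxisymmetric_forced_of_liouville hν h0A hfA hL,
    X.not_cylRadius_mul_norm_le_of_isAxisymmetric hν h0A hfA⟩

end ClayBlowup

end Summit.NavierStokesRegularity.FluidComputer

end
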